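import Summits.ResolutionOfSingularities.ResolutionOfSingularities.Theorems.WeightedInvariantDescentPerfectToAllOneRootReduction
import Summits.ResolutionOfSingularities.ResolutionOfSingularities.Theorems.WeightedInvariantDescentPerfectToAllOneRootReduceToIntegral
import Summits.ResolutionOfSingularities.ResolutionOfSingularities.Theorems.WeightedInvariantDescentPerfectToAllOneRootReduceToGeomIntegral

/-!
# `DescentPerfectToAll` (stmt-ResolutionOfSingularities-0549) is EQUIVALENT to the one-root step for geometrically
# integral varieties

Route `ResolutionOfSingularities/WeightedInvariant` (crux shared verbatim with `Descent` and `UniformComplexity`),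
line `root-of-a-constant` of the lead prover-line-stmt-ResolutionOfSingularities-0549-c1-0. Sequel to
`WeightedInvariantDescentPerfectToAllOneRootReduction.lean` (p106869: crux ⟺ one-root step for reduced `X`). Two
further registered stubs of the lead skeleton are theorems of the tree: `stub_oneRootReduceToIntegral` (p107667:
integral ⇒ reduced `X`, irreducible components) and `stub_oneRootReduceToGeomIntegral` (p108841: for integral `X`, if
`a ∈ k(X)^p` then `(X ⊗_k K)_red → X` is finite birational and the step is free, else `X ⊗_k K` is integral).
This file records, sorry-free, what they buy:

* `descentPerfectToAll_of_oneRootStepCore` — **the crux follows from the one-root step in its essential case**: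
  for every prime `p`, assuming resolution over all perfect fields of characteristic `p`: for `a ∈ k ∖ k^p`,
  `K = k(α)`, `α^p = a`, and `X` an INTEGRAL separated `k`-scheme of finite type with `X ⊗_k K` INTEGRAL
  (`a ∉ k(X)^p`), a resolution of `X ⊗_k K` yields a resolution of `X` (the registered stub `stub_oneRootStepCore`).
* `oneRootStepCore_of_descentPerfectToAll` — the converse (trivial).
* `descentPerfectToAll_iff_oneRootStepCore` — Temkin's perfect-to-all question (2008, Q. 3.3.3) is therefore
  equivalent to: "resolution of the variety `X` follows from resolution of its INTEGRAL purely inseparable degree-`p`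
  constant twist `X ⊗_k k(a^{1/p})`", one scalar at a time. By `stub_oneRootNormalization` (p112741) `X` may moreover
  be taken NORMAL (the line's one open stub `stub_oneRootStepCoreNormal`); that sharpening is recorded in the lead
  skeleton `Cruxes/DescentPerfectToAll/Lines/root_of_a_constant_c1.lean`. The core is summit-implied, it follows from
  route pAlteration's `Picover` (`descentPerfectToAll_of_picover`, `WeightedInvariantDescentPerfectToAllPicoverLink.lean`),
  and no proof of it is known in print.
-/

noncomputable section

set_option linter.dupNamespace false -- mandated namespace of this single-conjunct summit

open CategoryTheory CategoryTheory.Limits AlgebraicGeometry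
open Literature.AlgebraicGeometry.Resolution

namespace Summit.ResolutionOfSingularities.ResolutionOfSingularities.Theorems

/-- **The crux follows from the one-root step for geometrically integral varieties.** The hypothesis is verbatim
the registered stub `stub_oneRootStepCore` of the line `root-of-a-constant`; the proof threads it through the
landed reductions (geometric integrality p108841, irreducible components p107667) into the one-root step for reduced
schemes and then through `descentPerfectToAll_of_oneRootStep` (p106869: perfect closure, limit descent, radicial
tower). [folklore] -/
theorem descentPerfectToAll_of_oneRootStepCore : (∀ (p : ℕ) [Fact p.Prime], (∀ (κ : Type) [Field κ] [CharP κ p] [PerfectField κ] (Z : Scheme.{0}) (h : Z ⟶ Spec (.of κ)), IsSeparated h → LocallyOfFiniteType h → QuasiCompact h → IsReduced Z → Scheme.HasResolution Z) → (∀ (k K : Type) [Field k] [Field K] [Algebra k K] [CharP k p] (a : k) (α : K), (∀ b : k, b ^ p ≠ a) → α ^ p = algebraMap k K a → IntermediateField.adjoin k {α} = ⊤ → ∀ (X : Scheme.{0}) (f : X ⟶ Spec (.of k)), IsSeparated f → LocallyOfFiniteType f → QuasiCompact f → IsIntegral X → IsIntegral (pullback f (Spec.map (CommRingCat.ofHom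 (algebraMap k K)))) → Scheme.HasResolution (pullback f (Spec.map (CommRingCat.ofHom (algebraMap k K)))) → Scheme.HasResolution X)) → Summit.ResolutionOfSingularities.ResolutionOfSingularities.Theses.WeightedInvariant.DescentPerfectToAll :=
  fun hcore => descentPerfectToAll_of_oneRootStep fun p _ H =>
    stub_oneRootReduceToIntegral p (stub_oneRootReduceToGeomIntegral p (hcore p H))

/-- The converse: the crux implies the core (its conclusion `ResolutionInChar p` resolves `X` outright). [folklore] -/
theorem oneRootStepCore_of_descentPerfectToAll (h : Summit.ResolutionOfSingularities.ResolutionOfSingularities.Theses.WeightedInvariant.DescentPerfectToAll) : ∀ (p : ℕ) [Fact p.Prime], (∀ (κ : Type) [Field κ] [CharP κ p] [PerfectField κ] (Z : Scheme.{0}) (h : Z ⟶ Spec (.of κ)), IsSeparated h → LocallyOfFiniteType h → QuasiCompact h → IsReduced Z → Scheme.HasResolution Z) → (∀ (k K : Type) [Field k] [Field K] [Algebra k K] [CharP k p] (a : k) (α : K), (∀ b : k, b ^ p ≠ a) → α ^ p = algebraMap k K a → IntermediateField.adjoin k {α} = ⊤ → ∀ (X : Scheme.{0}) (f : X ⟶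 Spec (.of k)), IsSeparated f → LocallyOfFiniteType f → QuasiCompact f → IsIntegral X → IsIntegral (pullback f (Spec.map (CommRingCat.ofHom (algebraMap k K)))) → Scheme.HasResolution (pullback f (Spec.map (CommRingCat.ofHom (algebraMap k K)))) → Scheme.HasResolution X) := by
  intro p hp H k K _ _ _ _ _ _ _ _ _ X f hsep hlft hqc hint _ _
  haveI := hint
  exact h p hp.out H k X f hsep hlft hqc inferInstance

/-- **`DescentPerfectToAll` ⟺ the one-root step for geometrically integral varieties.** [folklore] -/
theorem descentPerfectToAll_iff_oneRootStepCore : Summit.ResolutionOfSingularities.ResolutionOfSingularities.Theses.WeightedInvariant.DescentPerfectToAll ↔ (∀ (p : ℕ) [Fact p.Prime], (∀ (κ : Type) [Field κ] [CharP κ p] [PerfectField κ] (Z : Scheme.{0}) (h : Z ⟶ Spec (.of κ)), IsSeparated h → LocallyOfFiniteType h → QuasiCompact h → IsReduced Z → Scheme.HasResolution Z) → (∀ (k K : Type) [Field k] [Field K] [Algebra k K] [CharP k p] (a : k) (α : K), (∀ b : k, b ^ p ≠ a) → α ^ p = algebraMap k K a → IntermediateField.adjoin k {α} = ⊤ → ∀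 (X : Scheme.{0}) (f : X ⟶ Spec (.of k)), IsSeparated f → LocallyOfFiniteType f → QuasiCompact f → IsIntegral X → IsIntegral (pullback f (Spec.map (CommRingCat.ofHom (algebraMap k K)))) → Scheme.HasResolution (pullback f (Spec.map (CommRingCat.ofHom (algebraMap k K)))) → Scheme.HasResolution X)) :=
  ⟨oneRootStepCore_of_descentPerfectToAll, descentPerfectToAll_of_oneRootStepCore⟩

end Summit.ResolutionOfSingularities.ResolutionOfSingularities.Theorems

end
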